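import Summits.Ventures.PercRepro.SixFourT4XA

/-!
# PercRepro — C-025 at `(6,4)`, §22.12.3 on the RANK-3-TRACE planes (mine-2 g15, PRECISION 3 = `MINE2-RLS.md`
§21.18.9.2 clarification 3; a feasibility draft for p3 to copy — mine-2 holds no PercRepro module)

Step (4) of `PLJlow` identifies the covering-pair sum with the terms of `Xbar′ (profile D)`.  The sum of
`Xcnt_le_sum_covPairs` (SixFourPLXbar.lean) runs over ALL planes of `M` and is NOT bounded by `Xbar′` (a free extension
of `M` adds covering pairs without changing `G`, its profile or `X`); the identification must run over the planes whose
trace on `G` has rank `3` — the planes `plane_trichotomy` lists.  This file is `Xcnt_le_sum_covPairs` on those planes: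

* `exists_plane_superset3` — every rank-`≤ 3` subset of `G` lies in a plane with a rank-`3` trace (the `Z′` of
  `exists_plane_superset`'s `suffices` and `clF_mem_planes_of_rank_three`);
* `planes3 M G`, `covPairs3 M G` — the rank-3-trace planes and the covering pairs among them;
* `planeOf3` — a rank-3-trace plane through a rank-`≤ 3` subset `Z ⊆ G` (a choice);
* **`Xcnt_le_sum_covPairs3`** — `X ≤ Σ_{(P, P′) ∈ covPairs3} 2^{|P ∩ P′ ∩ G|}`, the same injection
  `Z ↦ (P, P′, Z ∩ P′)`.

The four declarations `exists_insert_eRk_succ`, `Xset`, `mem_Xset`, `Xcnt_eq_card_Xset` are the landed ones of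
`SixFourT4XA.lean` (p3; imported above) — this is the XA form of `CovPairs3.lean` (mine-2 g18 recipe, regenerated g19).
-/

namespace PercRepro.SixFour

open Finset ThmH

variable {α : Type*} [DecidableEq α] {M : Matroid α} [M.Finite] {G : Finset α}

/-! ## Planes with a rank-`3` trace -/

/-- Every subset of `G` of rank at most `3` lies in a plane of `M` whose trace on `G` has rank `3` (`r(G) = 4`). -/
theorem exists_plane_superset3 (hG : G ⊆ gr M) (hr : M.eRk (G : Set α) = 4) {Z : Finset α} (hZ : Z ⊆ G)
    (h3 : M.eRk (Z : Set α) ≤ 3) : ∃ P ∈ planes M, Z ⊆ P ∧ M.eRk ((P ∩ G : Finset α) : Set α) = 3 := by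
  suffices h : ∀ j : ℕ, ∀ k : ℕ, k + j = 3 → ∀ Z : Finset α, Z ⊆ G → M.eRk (Z : Set α) = (k : ℕ∞) →
      ∃ Z' : Finset α, Z ⊆ Z' ∧ Z' ⊆ G ∧ M.eRk (Z' : Set α) = 3 by
    obtain ⟨k, hk, -⟩ := eRk_eq_nat M Z
    have hk3 : k ≤ 3 := by rw [hk] at h3; exact_mod_cast h3
    obtain ⟨Z', hZZ', hZ'G, hr3⟩ := h (3 - k) k (by omega) Z hZ hk
    obtain ⟨hP, hsub, hrk⟩ := clF_mem_planes_of_rank_three hG hZ'G hr3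
    exact ⟨clF M Z', hP, hZZ'.trans (hsub.trans Finset.inter_subset_left), hrk⟩
  intro j
  induction j with
  | zero =>
    intro k hk Z hZ hZk
    exact ⟨Z, Finset.Subset.refl Z, hZ, by rw [hZk]; exact_mod_cast (by omega : k = 3)⟩
  | succ j ih =>
    intro k hk Z hZ hZk
    obtain ⟨y, hyG, -, hy⟩ := exists_insert_eRk_succ hr hZk (by omega)
    obtain ⟨Z', h1, h2, h3⟩ := ih (k + 1) (by omega) (insert y Z) (Finset.insert_subset hyG hZ) (by rw [hy]; push_cast; rfl)
    exact ⟨Z', (Finset.subset_insert y Z).trans h1, h2, h3⟩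

/-- The planes of `M` whose trace on `G` has rank `3`. -/
noncomputable def planes3 (M : Matroid α) [M.Finite] (G : Finset α) : Finset (Finset α) :=
  (planes M).filter (fun P : Finset α => M.eRk ((P ∩ G : Finset α) : Set α) = 3)

/-- Membership in `planes3`. -/
theorem mem_planes3 {P : Finset α} :
    P ∈ planes3 M G ↔ P ∈ planes M ∧ M.eRk ((P ∩ G : Finset α) : Set α) = 3 := by
  unfold planes3
  rw [Finset.mem_filter]

/-- `planes3 M G ⊆ planes M`. -/
theorem planes3_subset : planes3 M G ⊆ planes M := Finset.filter_subset _ _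

/-- The COVERING PAIRS among the rank-3-trace planes: ordered pairs of distinct such planes whose union contains `G`. -/
noncomputable def covPairs3 (M : Matroid α) [M.Finite] (G : Finset α) : Finset (Finset α × Finset α) :=
  (planes3 M G ×ˢ planes3 M G).filter (fun pp => pp.1 ≠ pp.2 ∧ G ⊆ pp.1 ∪ pp.2)

/-- Membership in `covPairs3`. -/
theorem mem_covPairs3 {pp : Finset α × Finset α} :
    pp ∈ covPairs3 M G ↔ (pp.1 ∈ planes3 M G ∧ pp.2 ∈ planes3 M G) ∧ pp.1 ≠ pp.2 ∧ G ⊆ pp.1 ∪ pp.2 := by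
  unfold covPairs3
  rw [Finset.mem_filter, Finset.mem_product]

/-- A rank-3-trace plane through a subset `Z ⊆ G` of rank `≤ 3` (any choice; `∅` when the hypotheses fail). -/
noncomputable def planeOf3 (hG : G ⊆ gr M) (hr : M.eRk (G : Set α) = 4) (Z : Finset α) : Finset α :=
  if h : Z ⊆ G ∧ M.eRk (Z : Set α) ≤ 3 then Classical.choose (exists_plane_superset3 hG hr h.1 h.2) else ∅

/-- `planeOf3` is a rank-3-trace plane containing `Z`. -/
theorem planeOf3_spec (hG : G ⊆ gr M) (hr : M.eRk (G : Set α) = 4) {Z : Finset α} (hZ : Z ⊆ G)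
    (h3 : M.eRk (Z : Set α) ≤ 3) : planeOf3 hG hr Z ∈ planes3 M G ∧ Z ⊆ planeOf3 hG hr Z := by
  unfold planeOf3
  rw [dif_pos ⟨hZ, h3⟩]
  obtain ⟨hP, hsub, hrk⟩ := Classical.choose_spec (exists_plane_superset3 hG hr hZ h3)
  exact ⟨mem_planes3.2 ⟨hP, hrk⟩, hsub⟩

omit [DecidableEq α] in
/-- A rank-`4` set is not contained in a plane. -/
theorem not_subset_plane3 (hr : M.eRk (G : Set α) = 4) {P : Finset α} (hP : P ∈ planes M) : ¬ G ⊆ P := by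
  intro h
  have := M.eRk_mono (Finset.coe_subset.2 h)
  rw [hr, (mem_planes.1 hP).2.2] at this
  exact absurd this (by decide)

/-- The covering pair of a set `Z` counted by `X`: a rank-3-trace plane through `Z` and one through `G ∖ Z`. -/
theorem covPair3_of_mem_Xset (hG : G ⊆ gr M) (hr : M.eRk (G : Set α) = 4) {Z : Finset α} (hZ : Z ∈ Xset M G) :
    (planeOf3 hG hr Z, planeOf3 hG hr (G \ Z)) ∈ covPairs3 M G := by
  obtain ⟨hZG, hZ3, hZ3'⟩ := mem_Xset.1 hZ
  obtain ⟨hP, hZP⟩ := planeOf3_spec hG hr hZG hZ3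
  obtain ⟨hP', hZP'⟩ := planeOf3_spec hG hr (Finset.sdiff_subset) hZ3'
  rw [mem_covPairs3]
  refine ⟨⟨hP, hP'⟩, ?_, ?_⟩
  · intro heq
    simp only at heq
    apply not_subset_plane3 hr (mem_planes3.1 hP).1
    intro y hy
    by_cases hyZ : y ∈ Z
    · exact hZP hyZ
    · rw [heq]
      exact hZP' (Finset.mem_sdiff.2 ⟨hy, hyZ⟩)
  · intro y hy
    rw [Finset.mem_union]
    by_cases hyZ : y ∈ Z
    · exact Or.inl (hZP hyZ)
    · exact Or.inr (hZP' (Finset.mem_sdiff.2 ⟨hy, hyZ⟩))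

/-- `Z = (G ∖ P′) ∪ (Z ∩ P′)` when `Z ⊆ G` and `G ∖ Z ⊆ P′`. -/
theorem eq_sdiff_union_inter3 {Z P' : Finset α} (hZG : Z ⊆ G) (hc : G \ Z ⊆ P') :
    Z = (G \ P') ∪ (Z ∩ P') := by
  ext y
  rw [Finset.mem_union, Finset.mem_sdiff, Finset.mem_inter]
  constructor
  · intro hy
    by_cases hyP : y ∈ P'
    · exact Or.inr ⟨hy, hyP⟩
    · exact Or.inl ⟨hZG hy, hyP⟩
  · rintro (⟨hyG, hyP⟩ | ⟨hy, -⟩)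
    · by_contra hyZ
      exact hyP (hc (Finset.mem_sdiff.2 ⟨hyG, hyZ⟩))
    · exact hy

/-- **Lemma X̄ (22.12.3) on the rank-3-trace planes**: `X ≤ Σ_{(P, P′) ∈ covPairs3} 2^{|P ∩ P′ ∩ G|}`. -/
theorem Xcnt_le_sum_covPairs3 (hG : G ⊆ gr M) (hr : M.eRk (G : Set α) = 4) :
    Xcnt M G ≤ ∑ pp ∈ covPairs3 M G, 2 ^ (pp.1 ∩ pp.2 ∩ G).card := by
  classical
  rw [Xcnt_eq_card_Xset]
  have hcard : ((covPairs3 M G).sigma (fun pp => (pp.1 ∩ pp.2 ∩ G).powerset)).card =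
      ∑ pp ∈ covPairs3 M G, 2 ^ (pp.1 ∩ pp.2 ∩ G).card := by
    rw [Finset.card_sigma]
    exact Finset.sum_congr rfl (fun pp _ => Finset.card_powerset _)
  rw [← hcard]
  refine Finset.card_le_card_of_injOn
    (fun Z => (⟨(planeOf3 hG hr Z, planeOf3 hG hr (G \ Z)), Z ∩ planeOf3 hG hr (G \ Z)⟩ :
      Σ _ : Finset α × Finset α, Finset α)) ?_ ?_
  · intro Z hZ
    rw [Finset.mem_coe] at hZ
    rw [Finset.mem_coe, Finset.mem_sigma]
    refine ⟨covPair3_of_mem_Xset hG hr hZ, ?_⟩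
    obtain ⟨hZG, hZ3, hZ3'⟩ := mem_Xset.1 hZ
    obtain ⟨-, hZP⟩ := planeOf3_spec hG hr hZG hZ3
    rw [Finset.mem_powerset]
    intro y hy
    rw [Finset.mem_inter] at hy
    rw [Finset.mem_inter, Finset.mem_inter]
    exact ⟨⟨hZP hy.1, hy.2⟩, hZG hy.1⟩
  · intro Z₁ hZ₁ Z₂ hZ₂ heq
    rw [Finset.mem_coe] at hZ₁ hZ₂
    simp only at heq
    rw [Sigma.mk.inj_iff] at heq
    obtain ⟨h1, h2⟩ := heq
    have h1' : planeOf3 hG hr (G \ Z₁) = planeOf3 hG hr (G \ Z₂) := (Prod.mk.inj h1).2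
    have h2' : Z₁ ∩ planeOf3 hG hr (G \ Z₂) = Z₂ ∩ planeOf3 hG hr (G \ Z₂) := by
      have := eq_of_heq h2
      rwa [h1'] at this
    obtain ⟨hZG₁, -, hZ3₁⟩ := mem_Xset.1 hZ₁
    obtain ⟨hZG₂, -, hZ3₂⟩ := mem_Xset.1 hZ₂
    obtain ⟨-, hc₁⟩ := planeOf3_spec hG hr (Finset.sdiff_subset (s := G) (t := Z₁)) hZ3₁
    obtain ⟨-, hc₂⟩ := planeOf3_spec hG hr (Finset.sdiff_subset (s := G) (t := Z₂)) hZ3₂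
    rw [eq_sdiff_union_inter3 hZG₁ hc₁, eq_sdiff_union_inter3 hZG₂ hc₂, h1', h2']

/-- The restricted sum is at most the unrestricted one (`covPairs3 ⊆ covPairs` when both are defined): stated here on
the rank-3-trace planes only, as `planes3 ⊆ planes`. -/
theorem covPairs3_subset_product : covPairs3 M G ⊆ planes M ×ˢ planes M := by
  intro pp hpp
  obtain ⟨⟨h1, h2⟩, -, -⟩ := mem_covPairs3.1 hpp
  exact Finset.mem_product.2 ⟨planes3_subset h1, planes3_subset h2⟩

end PercRepro.SixFour
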